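import Mathlib.Data.Nat.NthRoot.Defs
import Mathlib.Computability.Language
import Mathlib.Computability.Encoding
import Mathlib.Algebra.CharZero.Defs
import Literature.Computability.AlgebraicComplexity.ArithCircuit
import Literature.Computability.AlgebraicComplexity.ValiantClasses
import Literature.Computability.AlgebraicComplexity.StandardFamilies
import Literature.Computability.Complexity.Classes
import Literature.Computability.Complexity.Nondeterministic
import Literature.Computability.Complexity.PolyHierarchy
import Literature.Computability.Complexity.CircuitClasses
import Literature.Computability.Complexity.ConstantDepth
import Literature.Computability.Complexity.BoolEncodings
import Literature.NumberTheory.LFunctions.DedekindZeta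
import HarnessLib

-- provenance: harness21/H21/H21/Statements/PNP/ValiantBooleanBridge.lean @ 9c1e647 (interim HEAD d8f2665); M5 mechanical rewrite
/-!
# Bridges between Valiant's classes and Boolean complexity (family PNP)

Target statements connecting the algebraic (Valiant) world `VP`, `VNP`, arithmetic circuits over
`ℤ` with Boolean complexity classes `P/poly`, `NP`, `PH`, `NC²`, `NEXP`, `NTIME`:

* **pnp.S26** Bürgisser's transfer theorem: `VP_k = VNP_k` over a field of characteristic zero
  implies, under the (number-field) generalised Riemann hypothesis, the collapse
  `P/poly = NP/poly = PH/poly`; over a finite field it implies `NC²/poly = PH/poly`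
  unconditionally (`burgisser_collapse_of_VP_eq_VNP_charZero`,
  `burgisser_collapse_of_VP_eq_VNP_finite`);
* **pnp.S39** Kabanets–Impagliazzo: if polynomial identity testing for division-free arithmetic
  circuits over `ℤ` is in `⋂_{ε>0} NTIME(2^{n^ε})`, then `NEXP ⊄ P/poly` or the permanent has no
  polynomial-size (constant-free) arithmetic circuits over `ℤ` (`kabanets_impagliazzo`), together
  with the real definitions it needs: a Boolean encoding `arithCircuitEncoding n` of
  `ArithCircuit ℤ (Fin n)` (with decoder and `decode_encode` proof), the encoder
  `encodeArithCircuit`, and the language `PITLanguage`.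

## Sources

* P. Bürgisser, *Completeness and Reduction in Algebraic Complexity Theory*, Springer 2000,
  Theorem 4.5 and Corollary 4.6; P. Bürgisser, *Cook's versus Valiant's hypothesis*,
  Theoret. Comput. Sci. 235 (2000) 71–88.
* P. Koiran, *Hilbert's Nullstellensatz is in the polynomial hierarchy*, J. Complexity 12 (1996)
  273–286 (the source of the GRH dependence).
* V. Kabanets, R. Impagliazzo, *Derandomizing polynomial identity tests means proving circuit
  lower bounds*, STOC 2003 / Comput. Complexity 13 (2004) 1–46, Theorem 1.1 (conference
  numbering, STOC 2003 pp. 355–364: Definition 1 and Theorem 18, p. 359; Corollary 21 there is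
  the `coRP` version).

## Design choices

* GRH form for **pnp.S26**. Bürgisser's Theorem 4.5 uses GRH only through Koiran 1996
  (elimination of algebraic constants by reduction modulo primes with prescribed roots, i.e. an
  effective Chebotarev density theorem), which needs the Riemann hypothesis for the Dedekind
  zeta functions of number fields. We therefore take `Literature.NumberTheory.LFunctions.ExtendedRiemannHypothesis` (the
  Dedekind/number-field form of the AntSieve prelude) as hypothesis, *not* merely the
  Dirichlet-`L`-function form `GeneralizedRiemannHypothesis`; the inventory tag `grh_dirichlet`
  is coarser, and the stronger hypothesis is in any case the safe direction for an implication.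
* The advice classes are `polyAdvice C` (`C/poly`) of the CplxCore prelude; `P/poly` in the
  circuit sense is `PPoly`, and `PPoly = polyAdvice P` is `PPoly_eq_polyAdvice_P`, whence the
  corollary `PPoly_eq_polyAdvice_NP_of_VP_eq_VNP`. The prelude's `NC k` is already the
  *non-uniform* class, so `polyAdvice (NC 2)` is non-uniform `NC²` (advice can be hard-wired);
  this is exactly Bürgisser's `NC²/poly`.
* Bürgisser's Corollary 4.6 in characteristic zero even gives `NC³/poly = P/poly = … = PH/poly`
  (and `NC²/poly = P/poly = NP/poly = PH/poly` over finite fields); we state the inventory's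
  (weaker) conclusions `P/poly = NP/poly = PH/poly`, resp. `NC²/poly = PH/poly`.
* **pnp.S39**: instances of PIT are pairs `⟨n, C⟩` with `C : ArithCircuit ℤ (Fin n)` (the
  prelude's straight-line programs with unbounded fan-in weighted-sum and product gates and
  arbitrary integer constants), encoded over `{0,1}` with the `BoolEncodings` combinators:
  operands and gates are tag bits followed by `encodingFinBool`/`encodingIntBool`/`encodeNat`
  payloads, operand lists via `Encoding.listBool`, pairs via `boolPair`; integer constants and
  sum coefficients are in binary. We build honest `Computability.Encoding`s (with decoders), so
  injectivity of the encoding is available (`encodeArithCircuit_injective`).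
* The subexponential hypothesis `PIT ∈ ⋂_{ε>0} NTIME(2^{n^ε})` is realised over `ε = 1/r`,
  `0 < r`, with the integer root `Nat.nthRoot r n = ⌊n^{1/r}⌋` (Mathlib), matching the cofinal
  `1/k` convention of `SUBEXP` in the CplxCore prelude; `NTIME` there is `O(·)`-robust.
* The algebraic disjunct of **pnp.S39** is "`(PER_n)` is not computable by polynomial-size
  arithmetic circuits over `ℤ`" in the *constant-free* sense `constantFreeComplexity` (constants
  and coefficients in `{0, 1, -1}`, `ArithCircuit.HasSignConstants`). Allowing binary-encoded
  integer constants of polynomial bit-size gives the same class of p-bounded families (an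
  integer of bit-size `ℓ` is built from `1` by `O(ℓ)` doublings and additions), which is the
  model of Kabanets–Impagliazzo. By contrast `IsPComputable` over a field (free constants) is
  a different, not obviously equivalent, notion and is *not* used here.
* Mathlib has no complexity classes, arithmetic circuits or PIT (searched `PIT`,
  `IdentityTest`, `ArithCircuit`, `NTIME`); reused: `Computability.Encoding`, `encodeNat`,
  `decodeNat`, `Language`, `Nat.nthRoot`.

Everything lives in `namespace Literature.PNP`, inside a `noncomputable section`.
-/

noncomputable section

open Computability Literature.Computability.Complexity Literature.Computability.Complexity.Nondeterministic Literature.Computability.Complexity.Classes Literature.Computability.AlgebraicComplexity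

namespace Literature.Computability.AlgebraicComplexity

universe u

/-! ### pnp.S26: Bürgisser's transfer theorems -/

section Burgisser

variable (k : Type u) [Field k]

/-- **pnp.S26** (Bürgisser 2000, Thm. 4.5 and Cor. 4.6(1); Bürgisser, *Cook's versus Valiant's
hypothesis*, TCS 2000). If `VP_k = VNP_k` over some field `k` of characteristic zero then,
assuming the generalised Riemann hypothesis, the non-uniform Boolean classes collapse:
`P/poly = NP/poly = PH/poly`. The GRH enters only through Koiran's (1996) elimination of
constants, which needs the Riemann hypothesis for Dedekind zeta functions of number fields;
hence the hypothesis is `Literature.NumberTheory.LFunctions.ExtendedRiemannHypothesis` (Dedekind form), not the Dirichlet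
form. Bürgisser's corollary even includes `NC³/poly` in the chain of equalities. Printed (TCS 235,
p. 74, Cor. 1.2(1)): "We assume (GRH). If Valiant's hypothesis were false over a field of
characteristic zero, then we had NC³/poly = P/poly = NP/poly = PH/poly and #P/poly = FP/poly";
(GRH) there (p. 83) is the Riemann hypothesis for the Dedekind zeta function `ζ_K` of number
fields. Book numbering Thm. 4.5 / Cor. 4.6(1) = paper numbering Thm. 1.1(1) / Cor. 1.2(1).
[cite: Burgisser2000TCS, Thm. 1.1(1) p. 73 and Cor. 1.2(1) p. 74] [cite: Burgisser2000, Thm. 4.5 and Cor. 4.6(1)] -/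
def burgisser_collapse_of_VP_eq_VNP_charZero : Prop :=
  ∀ [CharZero k] (hGRH : Literature.NumberTheory.LFunctions.ExtendedRiemannHypothesis) (h : VP k = VNP k),
    polyAdvice P = polyAdvice NP ∧ polyAdvice NP = polyAdvice PH

/-- **pnp.S26** (Bürgisser 2000, Thm. 4.5 and Cor. 4.6(2); Bürgisser, *Cook's versus Valiant's
hypothesis*, TCS 2000). If `VP_k = VNP_k` over some finite field `k` then, unconditionally,
`NC²/poly = PH/poly` (indeed `NC²/poly = P/poly = NP/poly = PH/poly`). Here `NC 2` is the
prelude's non-uniform class, so `polyAdvice (NC 2)` is non-uniform `NC²` (advice strings can be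
hard-wired into the circuits), which is Bürgisser's `NC²/poly`. Printed (TCS 235, p. 74,
Cor. 1.2(2)): "If Valiant's hypothesis were false over a finite field k of characteristic p, then
we had NC²/poly = P/poly = NP/poly = Mod_p NP/poly = PH/poly" (unconditional).
[cite: Burgisser2000TCS, Thm. 1.1(2) p. 73 and Cor. 1.2(2) p. 74] [cite: Burgisser2000, Thm. 4.5 and Cor. 4.6(2)] -/
def burgisser_collapse_of_VP_eq_VNP_finite : Prop :=
  ∀ [Finite k] (h : VP k = VNP k),
    polyAdvice (NC 2) = polyAdvice PH

/-- Corollary of **pnp.S26** in terms of the circuit class `PPoly` (`P/poly` as polynomial-size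
circuits, `PPoly_eq_polyAdvice_P`): `VP_k = VNP_k` in characteristic zero and GRH give
`P/poly = NP/poly` (Bürgisser 2000, Cor. 4.6; Karp–Lipton form; TCS 235 p. 74 Cor. 1.2(1)).
[cite: Burgisser2000TCS, Cor. 1.2(1) p. 74] [cite: Burgisser2000, Cor. 4.6(1)] -/
def PPoly_eq_polyAdvice_NP_of_VP_eq_VNP : Prop :=
  ∀ [CharZero k] (hGRH : Literature.NumberTheory.LFunctions.ExtendedRiemannHypothesis) (h : VP k = VNP k),
    PPoly = polyAdvice NP

/- interim proof relied on results that are now named facts (D-0014); demoted to a fact by the M5 import, proof preserved: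
:= by
  rw [PPoly_eq_polyAdvice_P]
  exact (burgisser_collapse_of_VP_eq_VNP_charZero k hGRH h).1
-/

end Burgisser

/-! ### pnp.S39: Boolean encoding of integer arithmetic circuits and PIT -/

section Encoding

variable (n : ℕ)

/-- Boolean encoding of operands of arithmetic circuits over `ℤ` in the variables `Fin n`:
`var i ↦ 00 · bin(i)`, `const c ↦ 01 · encodingIntBool c` (sign bit and binary absolute value),
`gate j ↦ 1 · bin(j)` (Kabanets–Impagliazzo 2004, §2: circuits as strings; Arora–Barak 2009,
§0.1). [cite: KabanetsImpagliazzo2004, §2: circuits as strings] -/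
def operandEncoding : Encoding (ArithCircuit.Operand ℤ (Fin n)) Bool where
  encode
    | .var i => false :: false :: (encodingFinBool n).encode i
    | .const c => false :: true :: encodingIntBool.encode c
    | .gate j => true :: encodeNat j
  decode
    | false :: false :: w => ((encodingFinBool n).decode w).map .var
    | false :: true :: w => (encodingIntBool.decode w).map .const
    | true :: w => some (.gate (decodeNat w))
    | _ => none
  decode_encode u := by
    cases u <;> simp [Encoding.decode_encode, decode_encodeNat]

/-- Boolean encoding of gates: a tag bit (`0` = weighted sum, `1` = product) followed by the
`Encoding.listBool` encoding of the operand list, the (coefficient, operand) pairs of a sum gate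
being paired by `Encoding.pairBool` with coefficients in binary (`encodingIntBool`)
(Kabanets–Impagliazzo 2004, §2; Arora–Barak 2009, §0.1). [cite: KabanetsImpagliazzo2004, §2] -/
def gateEncoding : Encoding (ArithCircuit.Gate ℤ (Fin n)) Bool where
  encode
    | .sum args => false :: (encodingIntBool.pairBool (operandEncoding n)).listBool.encode args
    | .prod args => true :: (operandEncoding n).listBool.encode args
  decode
    | false :: w => ((encodingIntBool.pairBool (operandEncoding n)).listBool.decode w).map .sum
    | true :: w => ((operandEncoding n).listBool.decode w).map .prod
    | [] => none
  decode_encode g := by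
    cases g <;> simp [Encoding.decode_encode]

/-- Boolean encoding of (division-free) arithmetic circuits over `ℤ` in the variables `Fin n`:
the pair `boolPair (list of gates) (output operand)` via `Encoding.pairBool`/`Encoding.listBool`
(Kabanets–Impagliazzo 2004, §2; Arora–Barak 2009, §0.1). The code length is linear in the
number of operand occurrences plus the bit-sizes of all constants and indices. [cite: KabanetsImpagliazzo2004, §2] -/
def arithCircuitEncoding : Encoding (ArithCircuit ℤ (Fin n)) Bool where
  encode C := ((gateEncoding n).listBool.pairBool (operandEncoding n)).encode (C.gates, C.output)
  decode w := (((gateEncoding n).listBool.pairBool (operandEncoding n)).decode w).map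
    fun p => ⟨p.1, p.2⟩
  decode_encode C := by
    rw [Encoding.decode_encode]
    rfl

/-- The Boolean code word of an integer arithmetic circuit in `n` variables,
`encodeArithCircuit n C = (arithCircuitEncoding n).encode C` (Kabanets–Impagliazzo 2004, §2). [cite: KabanetsImpagliazzo2004, §2] -/
def encodeArithCircuit (C : ArithCircuit ℤ (Fin n)) : List Bool :=
  (arithCircuitEncoding n).encode C

/-- The encoding of circuits is injective (it has a decoder). [folklore] -/
theorem encodeArithCircuit_injective : Function.Injective (encodeArithCircuit n) :=
  (arithCircuitEncoding n).encode_injective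

/-- Boolean encoding of PIT instances `⟨n, C⟩`, `C : ArithCircuit ℤ (Fin n)`:
`boolPair (bin n) (encodeArithCircuit n C)`, i.e. `Encoding.sigmaBool arithCircuitEncoding`
(Kabanets–Impagliazzo 2004, §2; Arora–Barak 2009, §0.1). [cite: KabanetsImpagliazzo2004, §2] -/
def pitInstanceEncoding : Encoding (Σ n : ℕ, ArithCircuit ℤ (Fin n)) Bool :=
  Encoding.sigmaBool arithCircuitEncoding

end Encoding

/-- The language `PIT` of *polynomial identity testing* for division-free arithmetic circuits
over `ℤ`: the code words `boolPair (bin n) (encodeArithCircuit n C)` of pairs `⟨n, C⟩` with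
`C : ArithCircuit ℤ (Fin n)` computing the zero polynomial, `C.eval = 0`
(Kabanets–Impagliazzo 2004, §1 and §2, problem "Arithmetic Circuit Identity Testing"). [cite: KabanetsImpagliazzo2004, §1 and §2  problem "Arithmetic Circuit I] -/
def PITLanguage : Language Bool :=
  {w | ∃ (n : ℕ) (C : ArithCircuit ℤ (Fin n)),
    boolPair (encodeNat n) (encodeArithCircuit n C) = w ∧ C.eval = 0}

/-- `PITLanguage` is the language of the set `{⟨n, C⟩ | C.eval = 0}` under the encoding
`pitInstanceEncoding` (`Encoding.toLanguage`); definitional bookkeeping. [folklore] -/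
theorem PITLanguage_eq_toLanguage :
    PITLanguage = pitInstanceEncoding.toLanguage {p | p.2.eval = 0} := by
  ext w
  simp only [PITLanguage, Encoding.toLanguage]
  constructor
  · rintro ⟨n, C, rfl, hC⟩
    exact ⟨⟨n, C⟩, hC, rfl⟩
  · rintro ⟨⟨n, C⟩, hC, rfl⟩
    exact ⟨n, C, rfl, hC⟩

/-- Membership of a code word in `PITLanguage` is vanishing of the computed polynomial
(injectivity of the encoding; Kabanets–Impagliazzo 2004, §2). [cite: KabanetsImpagliazzo2004, §2] -/
theorem mem_PITLanguage_iff (n : ℕ) (C : ArithCircuit ℤ (Fin n)) :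
    boolPair (encodeNat n) (encodeArithCircuit n C) ∈ PITLanguage ↔ C.eval = 0 := by
  rw [PITLanguage_eq_toLanguage]
  exact pitInstanceEncoding.mem_toLanguage_iff {p | p.2.eval = 0} ⟨n, C⟩

/-! ### pnp.S39: the Kabanets–Impagliazzo theorem -/

/-- **pnp.S39** (Kabanets–Impagliazzo 2004, Thm. 1.1 = STOC 2003, Def. 1 + Thm. 18). If polynomial
identity testing for division-free arithmetic circuits over `ℤ` can be solved in nondeterministic
subexponential time, `PIT ∈ ⋂_{ε>0} NTIME(2^{n^ε})` (realised as `ε = 1/r`, `0 < r`, with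
`Nat.nthRoot r n = ⌊n^{1/r}⌋`), then either `NEXP ⊄ P/poly` or the permanent family `(PER_n)`
is not computable by polynomial-size arithmetic circuits over `ℤ`. The latter is stated in the
constant-free model (`constantFreeComplexity`, constants and coefficients in `{0, 1, -1}`);
allowing binary integer constants of polynomial bit-size, as Kabanets–Impagliazzo do, yields the
same notion of polynomial size, whereas p-computability over a field with free constants
(`IsPComputable`) is a different notion. Locator note: in the STOC 2003 extended abstract the
statement is Def. 1 ("NEXP is not computable by polynomial-size arithmetic circuits" := `NEXP ⊄
P/poly` or Perm has no polynomial-size arithmetic circuits) with Thm. 18 (p. 359, ACIT in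
`NTIME(2^{n^ε})` for every `ε > 0`); Cor. 21 is the `coRP`-version. The conditional derivation
from the tree's named facts is `kabanets_impagliazzo_of_facts` (`ValiantBooleanBridgeProofs.lean`).
[cite: KabanetsImpagliazzo2004, Thm. 1.1] [cite: KabanetsImpagliazzo2003, Def. 1 and Thm. 18 (p. 359)] -/
def kabanets_impagliazzo : Prop :=
  ∀ (h : ∀ r : ℕ, 0 < r → PITLanguage ∈ NTIME (fun n => 2 ^ Nat.nthRoot r n)),
    ¬ (NEXP ⊆ PPoly) ∨ ¬ IsPBounded (fun n => constantFreeComplexity (perPoly (Fin n) ℤ))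

end Literature.Computability.AlgebraicComplexity
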